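import Summits.FinalStateConjecture.FinalStateConjecture.Theorems.StarvedNecksNeckGapDecayGlueSelfMap
import HarnessLib

/-!
# Gluing toolbox for the gap certificate, IV: late bounds of the interpolation field, real-variable helpers
# (crux `StarvedNecks.NeckGapDecay`, stmt-FinalStateConjecture-16768, line `Sketch`, packaging stub P-glue `stub_certOfCoreFrom`)

`late_field_bounds`: with the moving-shell cut-off `χ` (stub W3) and a smooth `T` whose `C³`-distance to the
identity is `≤ e` on the late collar `{ϱ(t)+1 ≤ s ≤ ϱ(t)+4}`, the field `P = χ·(T − id)` of the belt construction
has `‖P‖ ≤ e`, `‖DʲP‖ ≤ 8 G e` (`j ≤ 3`) at every late point (Leibniz on the shell, identically zero off it).  Plus: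
`|ϱ(u) − ϱ(v)| ≤ |u − v|` from `|ϱ′| ≤ 1`, an `ε`-criterion for `Tendsto _ atTop (𝓝 0)` in `ℝ≥0∞`, and the rest-frame
comparison `s ≤ r + |a|`.  Elementary ([folklore]); no new definitions.
-/

noncomputable section

open scoped Manifold ContDiff Topology ENNReal
open Filter Set Function Topology Literature.Geometry.Lorentzian

namespace Summit.FinalStateConjecture.FinalStateConjecture.Theorems.NeckGapDecay.ConnectionLevelCones.Glue

set_option linter.dupNamespace false

/-! ## Late pointwise bounds of the interpolation field `P = χ·(T − id)` -/

/-- **Late `C³` bounds of `P = χ·(T − id)`.**  With the moving-shell cut-off `χ` of stub W3 (zero where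
`s ≤ ϱ(t) + 3/2` or `s ≥ ϱ(t) + 7/2`, all derivatives of order `≤ 3` bounded by `G`) and a smooth `T` whose
`C³`-distance to the identity is `≤ e` at every point of the collar `{ϱ(t)+1 ≤ s ≤ ϱ(t)+4}` with `t ≥ τa`, the
field `P` satisfies `‖P‖ ≤ e` and `‖DʲP‖ ≤ 8 G e` (`j = 1,2,3`) at every point with `t ≥ τa` (Leibniz on the collar,
`norm_iteratedFDeriv_smul_sub_le`; locally zero off the shell). [folklore] -/
theorem late_field_bounds (Λ : lorentzGroup) (c : E4) {ϱ : ℝ → ℝ} (hϱc : Continuous ϱ) {χ : E4 → ℝ}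
    {T : E4 → E4} (hχs : ContDiff ℝ ∞ χ) (hχ01 : ∀ x, 0 ≤ χ x ∧ χ x ≤ 1)
    (hχ0in : ∀ x, E4.spatialNorm (poincareInv Λ c x) ≤ ϱ (poincareInv Λ c x 0) + 3 / 2 → χ x = 0)
    (hχ0out : ∀ x, ϱ (poincareInv Λ c x 0) + 7 / 2 ≤ E4.spatialNorm (poincareInv Λ c x) → χ x = 0)
    {G : ℝ} (hG : 0 ≤ G) (hχG : ∀ j, j ≤ 3 → ∀ x, ‖iteratedFDeriv ℝ j χ x‖ ≤ G) (hTs : ContDiff ℝ ∞ T)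
    {e τa : ℝ} (he : 0 ≤ e)
    (hTb : ∀ x : E4, τa ≤ poincareInv Λ c x 0 →
      ϱ (poincareInv Λ c x 0) + 1 ≤ E4.spatialNorm (poincareInv Λ c x) →
      E4.spatialNorm (poincareInv Λ c x) ≤ ϱ (poincareInv Λ c x 0) + 4 →
      ∀ j, j ≤ 3 → ‖iteratedFDeriv ℝ j (fun y ↦ T y - y) x‖ ≤ e)
    {x : E4} (hx : τa ≤ poincareInv Λ c x 0) :
    ‖χ x • (T x - x)‖ ≤ e ∧
      ∀ j, 1 ≤ j → j ≤ 3 → ‖iteratedFDeriv ℝ j (fun y ↦ χ y • (T y - y)) x‖ ≤ 8 * G * e := by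
  have hcont_s : Continuous fun y : E4 ↦ E4.spatialNorm (poincareInv Λ c y) := continuous_spatialNorm Λ c
  have hcont_ϱt : Continuous fun y : E4 ↦ ϱ (poincareInv Λ c y 0) := hϱc.comp (continuous_time Λ c)
  have h8 : 0 ≤ 8 * G * e := by positivity
  by_cases hin : E4.spatialNorm (poincareInv Λ c x) < ϱ (poincareInv Λ c x 0) + 3 / 2
  · -- inside the seam ball: `P` vanishes near `x`
    have hU : IsOpen {y : E4 | E4.spatialNorm (poincareInv Λ c y) < ϱ (poincareInv Λ c y 0) + 3 / 2} :=
      isOpen_lt hcont_s (hcont_ϱt.add continuous_const)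
    have hχU : ∀ y ∈ {y : E4 | E4.spatialNorm (poincareInv Λ c y) < ϱ (poincareInv Λ c y 0) + 3 / 2}, χ y = 0 :=
      fun y hy ↦ hχ0in y (le_of_lt hy)
    refine ⟨?_, fun j _ _ ↦ ?_⟩
    · rw [hχ0in x hin.le, zero_smul, norm_zero]; exact he
    · rw [iteratedFDeriv_smul_sub_eq_zero hU hχU hin j, norm_zero]; exact h8
  by_cases hout : ϱ (poincareInv Λ c x 0) + 7 / 2 < E4.spatialNorm (poincareInv Λ c x)
  · -- beyond the shell: `P` vanishes near `x`
    have hU : IsOpen {y : E4 | ϱ (poincareInv Λ c y 0) + 7 / 2 < E4.spatialNorm (poincareInv Λ c y)} :=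
      isOpen_lt (hcont_ϱt.add continuous_const) hcont_s
    have hχU : ∀ y ∈ {y : E4 | ϱ (poincareInv Λ c y 0) + 7 / 2 < E4.spatialNorm (poincareInv Λ c y)}, χ y = 0 :=
      fun y hy ↦ hχ0out y (le_of_lt hy)
    refine ⟨?_, fun j _ _ ↦ ?_⟩
    · rw [hχ0out x hout.le, zero_smul, norm_zero]; exact he
    · rw [iteratedFDeriv_smul_sub_eq_zero hU hχU hout j, norm_zero]; exact h8
  -- on the shell `ϱ + 3/2 ≤ s ≤ ϱ + 7/2 ⊆` collar: Leibniz
  push Not at hin hout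
  have hcol := hTb x hx (by linarith) (by linarith)
  refine ⟨?_, fun j _ hj ↦ ?_⟩
  · refine norm_smul_sub_le hχ01 (Or.inr ?_) he
    have h0 := hcol 0 (by norm_num)
    rwa [norm_iteratedFDeriv_zero] at h0
  · exact norm_iteratedFDeriv_smul_sub_le hχs hTs hG he (fun j hj ↦ hχG j hj x) hcol hj

/-- `ϱ` with `|ϱ′| ≤ 1` is `1`-Lipschitz. [folklore] -/
theorem abs_sub_le_of_deriv {ϱ : ℝ → ℝ} (hϱs : ContDiff ℝ ∞ ϱ) (hϱ1 : ∀ u, |deriv ϱ u| ≤ 1) (u v : ℝ) :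
    |ϱ u - ϱ v| ≤ |u - v| := by
  have hd : Differentiable ℝ ϱ := hϱs.differentiable (by simp)
  have hlip : LipschitzWith 1 ϱ := by
    refine lipschitzWith_of_nnnorm_deriv_le hd fun u ↦ ?_
    have h := hϱ1 u
    rw [← Real.norm_eq_abs, ← coe_nnnorm] at h
    exact_mod_cast h
  have h := hlip.dist_le_mul u v
  rw [NNReal.coe_one, one_mul, Real.dist_eq, Real.dist_eq] at h
  exact h

/-- Rest-frame comparison `s ≤ r + |a|` at a lab point (`‖z⃗‖² − a² ≤ r²` at `z = Λ⁻¹(y − c)`). [folklore] -/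
theorem spatialNorm_poincareInv_le_radius_add_abs (Λ : lorentzGroup) (c : E4) (a : ℝ) (y : E4) :
    E4.spatialNorm (poincareInv Λ c y) ≤ Kerr.radius a (poincareInv Λ c y) + |a| := by
  have h := Kerr.spatialNorm_sq_sub_sq_le_radius_sq a (poincareInv Λ c y)
  have hr := Kerr.radius_nonneg a (poincareInv Λ c y)
  have hs : 0 ≤ E4.spatialNorm (poincareInv Λ c y) := norm_nonneg _
  have h1 : E4.spatialNorm (poincareInv Λ c y) ^ 2 ≤ (Kerr.radius a (poincareInv Λ c y) + |a|) ^ 2 := by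
    rw [← sq_abs a] at h
    nlinarith [abs_nonneg a]
  exact (sq_le_sq₀ hs (by positivity)).mp h1

/-- A family in `ℝ≥0∞` which is eventually `≤ C·ε` for every real `ε > 0` tends to `0`. [folklore] -/
theorem tendsto_zero_of_forall_eventually_le {f : ℝ → ℝ≥0∞} {C : ℝ} (hC : 0 ≤ C)
    (h : ∀ ε : ℝ, 0 < ε → ∃ τε : ℝ, ∀ τ, τε ≤ τ → f τ ≤ ENNReal.ofReal (C * ε)) :
    Tendsto f atTop (𝓝 0) := by
  rw [ENNReal.tendsto_atTop_zero]
  intro e he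
  by_cases htop : e = ⊤
  · obtain ⟨τε, hτε⟩ := h 1 one_pos
    exact ⟨τε, fun τ hτ ↦ (hτε τ hτ).trans (htop ▸ le_top)⟩
  · have he' : 0 < e.toReal := ENNReal.toReal_pos he.ne' htop
    obtain ⟨τε, hτε⟩ := h (e.toReal / (C + 1)) (by positivity)
    refine ⟨τε, fun τ hτ ↦ (hτε τ hτ).trans ?_⟩
    have h1 : C * (e.toReal / (C + 1)) ≤ e.toReal := by
      rw [mul_div_assoc']
      rw [div_le_iff₀ (by positivity)]
      nlinarith
    calc ENNReal.ofReal (C * (e.toReal / (C + 1))) ≤ ENNReal.ofReal e.toReal := ENNReal.ofReal_le_ofReal h1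
      _ = e := ENNReal.ofReal_toReal htop

end Summit.FinalStateConjecture.FinalStateConjecture.Theorems.NeckGapDecay.ConnectionLevelCones.Glue

end
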